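import Literature.Analysis.OperatorTheory.HalfLinePositiveDefinite
import Mathlib.Analysis.Calculus.ParametricIntegral
import Mathlib.Analysis.Complex.CauchyIntegral
import Mathlib.Analysis.Analytic.IsolatedZeros
import Mathlib.Analysis.SpecialFunctions.ExpDeriv
import HarnessLib

/-!
# Bounded positive-definite functions on the open half-line, II: holomorphic extension

Continuation of `HalfLinePositiveDefinite.lean`. From the Laplace representations
`f (2s + t) = ∫ e^{-tE} dν_s(E)` (`s > 0`; `IsBoundedHalfLinePD.exists_laplace_repr`) we build ONE
holomorphic function on the open right half-plane extending `f` and dominated by `f ∘ Re`: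

* `laplace_differentiableOn`, `norm_laplace_le` — the Laplace transform `w ↦ ∫ e^{-wE} dν(E)` of a
  finite positive measure on `[0, ∞)` is holomorphic on `{Re w > 0}` with `|∫ e^{-wE} dν| ≤ ∫ e^{-(Re w)E} dν`;
* `IsBoundedHalfLinePD.exists_holomorphic_extension` — **a bounded positive-definite `f` on `((0,∞),+)`
  is the restriction of a function `Φ` holomorphic on `{Re z > 0}` with `‖Φ z‖ ≤ f (Re z)`** (the
  pieces `z ↦ ∫ e^{-(z - 2s)E} dν_s`, `Re z > 2s`, agree on real points, hence on overlaps by the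
  identity theorem, and are glued along `s = Re z / 4`).

This is the form in which reflection positivity of a kernel in ONE mirror is consumed by the planar
rigidity argument of route CriticalPhenomena/…/HyperoctahedralRP (crux `HRP2Rigidity`, stub S1):
Berg–Christensen–Ressel (1984) Ch. 4 §4 / Widder (1941) Thm VI.21, half-plane form.
-/

noncomputable section

open MeasureTheory Filter Set Complex
open _root_.Topology

namespace Literature.Analysis.OperatorTheory

/-! ### The Laplace transform of a finite positive measure on `[0, ∞)` -/

section Laplace

variable (ν : Measure ℝ) [IsFiniteMeasure ν]

/-- `E ↦ e^{-wE}` is a.e. bounded by `1` on `[0,∞)` when `Re w ≥ 0`. [folklore] -/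
theorem norm_cexp_neg_mul_le {w : ℂ} (hw : 0 ≤ w.re) {E : ℝ} (hE : 0 ≤ E) :
    ‖cexp (-(w * E))‖ ≤ 1 := by
  rw [norm_exp]
  refine Real.exp_le_one_iff.2 ?_
  simp only [neg_re, mul_re, ofReal_re, ofReal_im, mul_zero, sub_zero, Left.neg_nonpos_iff]
  exact mul_nonneg hw hE

variable {ν} in
omit [IsFiniteMeasure ν] in
/-- Nonnegativity a.e. from `ν (Iio 0) = 0`. [folklore] -/
theorem ae_nonneg_of_measure_Iio (hν : ν (Iio 0) = 0) : ∀ᵐ E ∂ν, 0 ≤ E := by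
  have h : ∀ᵐ E ∂ν, E ∉ Iio (0 : ℝ) := measure_eq_zero_iff_ae_notMem.1 hν
  filter_upwards [h] with E hE
  simpa using hE

/-- Integrability of `E ↦ e^{-wE}` (`Re w ≥ 0`) against a finite measure on `[0, ∞)`. [folklore] -/
theorem integrable_cexp_neg_mul (hν : ν (Iio 0) = 0) {w : ℂ} (hw : 0 ≤ w.re) :
    Integrable (fun E : ℝ => cexp (-(w * E))) ν := by
  refine Integrable.mono' (integrable_const (1 : ℝ)) (by fun_prop) ?_
  filter_upwards [ae_nonneg_of_measure_Iio hν] with E hE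
  exact norm_cexp_neg_mul_le hw hE

/-- **The Laplace transform of a finite positive measure on `[0,∞)` is holomorphic on the open
right half-plane** (differentiation under the integral sign, dominated by `E e^{-εE} ≤ ε⁻¹`).
[folklore] -/
theorem laplace_differentiableOn (hν : ν (Iio 0) = 0) :
    DifferentiableOn ℂ (fun w : ℂ => ∫ E, cexp (-(w * E)) ∂ν) {w : ℂ | 0 < w.re} := by
  intro w₀ hw₀
  have hw₀' : 0 < w₀.re := hw₀
  set ε : ℝ := w₀.re / 2 with hε
  have hεpos : 0 < ε := by positivity
  set F' : ℂ → ℝ → ℂ := fun w E => cexp (-(w * E)) * -(1 * (E : ℂ)) with hF'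
  set U : Set ℂ := {w : ℂ | ε < w.re} with hU
  have hUmem : U ∈ 𝓝 w₀ :=
    (isOpen_lt continuous_const Complex.continuous_re).mem_nhds (show ε < w₀.re by rw [hε]; linarith)
  have key := hasDerivAt_integral_of_dominated_loc_of_deriv_le (μ := ν) (F := fun w E => cexp (-(w * E)))
    (F' := F') (x₀ := w₀) (bound := fun _ => ε⁻¹) (s := U) hUmem ?_ (integrable_cexp_neg_mul ν hν hw₀'.le)
    (by fun_prop) ?_ (integrable_const _) ?_
  · exact key.2.differentiableAt.differentiableWithinAt
  · exact Eventually.of_forall fun w => by fun_prop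
  · filter_upwards [ae_nonneg_of_measure_Iio hν] with E hE w hw
    have hwre : ε ≤ w.re := le_of_lt hw
    rw [hF']
    dsimp only
    rw [norm_mul, norm_neg, one_mul, Complex.norm_real, Real.norm_of_nonneg hE, Complex.norm_exp]
    simp only [neg_re, mul_re, ofReal_re, ofReal_im, mul_zero, sub_zero]
    -- `e^{-Re w · E} E ≤ e^{-εE} E ≤ ε⁻¹`
    have h1 : Real.exp (-(w.re * E)) ≤ Real.exp (-(ε * E)) :=
      Real.exp_le_exp.2 (by nlinarith)
    have h2 : Real.exp (-(ε * E)) * E ≤ ε⁻¹ := by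
      rw [Real.exp_neg, inv_mul_le_iff₀ (Real.exp_pos _), ← div_eq_mul_inv, le_div_iff₀ hεpos]
      nlinarith [Real.add_one_le_exp (ε * E)]
    calc Real.exp (-(w.re * E)) * E ≤ Real.exp (-(ε * E)) * E := mul_le_mul_of_nonneg_right h1 hE
      _ ≤ ε⁻¹ := h2
  · filter_upwards with E w _
    rw [hF']
    exact (((hasDerivAt_id w).mul_const (E : ℂ)).neg).cexp

omit [IsFiniteMeasure ν] in
/-- `|∫ e^{-wE} dν| ≤ ∫ e^{-(Re w)E} dν`. [folklore] -/
theorem norm_laplace_le (w : ℂ) :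
    ‖∫ E, cexp (-(w * E)) ∂ν‖ ≤ ∫ E, Real.exp (-(w.re * E)) ∂ν := by
  refine (norm_integral_le_integral_norm _).trans (le_of_eq ?_)
  refine integral_congr_ae (Eventually.of_forall fun E => ?_)
  show ‖cexp (-(w * E))‖ = Real.exp (-(w.re * E))
  rw [Complex.norm_exp]
  simp only [neg_re, mul_re, ofReal_re, ofReal_im, mul_zero, sub_zero]

omit [IsFiniteMeasure ν] in
/-- At real points the complex Laplace transform is the real one. [folklore] -/
theorem laplace_ofReal (t : ℝ) :
    ∫ E, cexp (-((t : ℂ) * E)) ∂ν = ((∫ E, Real.exp (-(t * E)) ∂ν : ℝ) : ℂ) := by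
  rw [← integral_complex_ofReal]
  refine integral_congr_ae (Eventually.of_forall fun E => ?_)
  show cexp (-((t : ℂ) * E)) = ((Real.exp (-(t * E)) : ℝ) : ℂ)
  rw [Complex.ofReal_exp]
  push_cast
  ring_nf

end Laplace

/-! ### Gluing the shifted representations -/

namespace IsBoundedHalfLinePD

variable {f : ℝ → ℝ}

/-- Real points of `(a, ∞)` accumulate at `a + 1` inside `{z ≠ a + 1}`: a predicate holding at all
real `t > a` holds frequently along `𝓝[≠] (a + 1 : ℂ)`. [folklore] -/
theorem frequently_nhdsNE_ofReal {a : ℝ} {P : ℂ → Prop} (hP : ∀ t : ℝ, a < t → P t) :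
    ∃ᶠ z in 𝓝[≠] ((a + 1 : ℝ) : ℂ), P z := by
  have htend : Tendsto (fun t : ℝ => (t : ℂ)) (𝓝[>] (a + 1)) (𝓝[≠] ((a + 1 : ℝ) : ℂ)) := by
    refine tendsto_nhdsWithin_of_tendsto_nhds_of_eventually_within _
      (Complex.continuous_ofReal.continuousAt.mono_left nhdsWithin_le_nhds) ?_
    filter_upwards [self_mem_nhdsWithin] with t ht
    simp only [mem_compl_iff, mem_singleton_iff, Complex.ofReal_inj]
    exact ne_of_gt ht
  refine htend.frequently ?_
  refine Eventually.frequently ?_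
  filter_upwards [self_mem_nhdsWithin] with t ht
  exact hP t (lt_trans (by linarith) ht)

/-- **Holomorphic extension to the right half-plane.** A bounded positive-definite function `f` on
`((0,∞),+)` is the restriction of a function `Φ` holomorphic on `{Re z > 0}` with `‖Φ z‖ ≤ f (Re z)`
(Berg–Christensen–Ressel 1984, Ch. 4 §4; Widder 1941, Thm VI.21, in half-plane form: `f` is a Laplace
transform of a positive measure on each `(2s, ∞)`). [cite: BergChristensenRessel1984, Ch. 4 §4] -/
theorem exists_holomorphic_extension (hf : IsBoundedHalfLinePD f) :
    ∃ Φ : ℂ → ℂ, DifferentiableOn ℂ Φ {z : ℂ | 0 < z.re} ∧ (∀ t : ℝ, 0 < t → Φ t = f t) ∧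
      ∀ z : ℂ, 0 < z.re → ‖Φ z‖ ≤ f z.re := by
  choose ν hfin hIio hrep using fun (s : ℝ) (hs : 0 < s) => hf.exists_laplace_repr hs
  -- the piece defined on `Re z > 2s`
  set G : (s : ℝ) → 0 < s → ℂ → ℂ := fun s hs z => ∫ E, cexp (-((z - 2 * s) * E)) ∂(ν s hs) with hG
  have hGdiff : ∀ (s : ℝ) (hs : 0 < s), DifferentiableOn ℂ (G s hs) {z : ℂ | 2 * s < z.re} := by
    intro s hs
    haveI := hfin s hs
    have h := laplace_differentiableOn (ν s hs) (hIio s hs)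
    have h2 : DifferentiableOn ℂ (fun z : ℂ => z - 2 * s) {z : ℂ | 2 * s < z.re} := by fun_prop
    refine (h.comp h2 fun z hz => ?_).congr fun z _ => by simp [hG]
    simp only [mem_setOf_eq, sub_re] at hz ⊢
    have : ((2 : ℂ) * (s : ℂ)).re = 2 * s := by simp
    linarith
  have hGreal : ∀ (s : ℝ) (hs : 0 < s) (t : ℝ), 2 * s < t → G s hs t = f t := by
    intro s hs t ht
    haveI := hfin s hs
    have h1 : G s hs t = ∫ E, cexp (-(((t - 2 * s : ℝ) : ℂ) * E)) ∂(ν s hs) := by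
      simp only [hG]; push_cast; rfl
    rw [h1, laplace_ofReal, ← hrep s hs (t - 2 * s) (by linarith)]
    congr 1; congr 1; ring
  have hGnorm : ∀ (s : ℝ) (hs : 0 < s) (z : ℂ), 2 * s < z.re → ‖G s hs z‖ ≤ f z.re := by
    intro s hs z hz
    haveI := hfin s hs
    have h1 : G s hs z = ∫ E, cexp (-((z - 2 * s) * E)) ∂(ν s hs) := rfl
    rw [h1]
    refine (norm_laplace_le (ν s hs) _).trans (le_of_eq ?_)
    have hre : (z - 2 * (s : ℂ)).re = z.re - 2 * s := by simp
    have h2 : f z.re = f (2 * s + (z.re - 2 * s)) := by congr 1; ring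
    rw [hre, h2, hrep s hs (z.re - 2 * s) (by linarith)]
  -- consistency of the pieces on overlaps (identity theorem from the real points)
  have hcons : ∀ (s : ℝ) (hs : 0 < s) (s' : ℝ) (hs' : 0 < s'), s ≤ s' →
      EqOn (G s hs) (G s' hs') {z : ℂ | 2 * s' < z.re} := by
    intro s hs s' hs' hss'
    have hU : IsPreconnected {z : ℂ | 2 * s' < z.re} :=
      (convex_halfSpace_re_gt (2 * s')).isPreconnected
    have hopen : IsOpen {z : ℂ | 2 * s' < z.re} := isOpen_lt continuous_const Complex.continuous_re
    have h1 : AnalyticOnNhd ℂ (G s hs) {z : ℂ | 2 * s' < z.re} :=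
      ((hGdiff s hs).mono fun z (hz : 2 * s' < z.re) => show 2 * s < z.re by
        linarith).analyticOnNhd hopen
    have h2 : AnalyticOnNhd ℂ (G s' hs') {z : ℂ | 2 * s' < z.re} := (hGdiff s' hs').analyticOnNhd hopen
    have hz₀ : ((2 * s' + 1 : ℝ) : ℂ) ∈ {z : ℂ | 2 * s' < z.re} := by
      simp only [mem_setOf_eq, Complex.ofReal_re]; linarith
    refine h1.eqOn_of_preconnected_of_frequently_eq h2 hU hz₀ ?_
    exact frequently_nhdsNE_ofReal fun t ht => by
      rw [hGreal s hs t (by linarith), hGreal s' hs' t ht]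
  -- the glued function
  refine ⟨fun z => if h : 0 < z.re then G (z.re / 4) (by positivity) z else 0, ?_, ?_, ?_⟩
  · intro z₀ hz₀
    have hz₀' : 0 < z₀.re := hz₀
    set s₀ : ℝ := z₀.re / 4 with hs₀
    have hs₀pos : 0 < s₀ := by positivity
    have hopen : IsOpen {z : ℂ | z₀.re / 2 < z.re} := isOpen_lt continuous_const Complex.continuous_re
    have hmem : z₀ ∈ {z : ℂ | z₀.re / 2 < z.re} := by simp only [mem_setOf_eq]; linarith
    have heq : (fun z => if h : 0 < z.re then G (z.re / 4) (by positivity) z else 0) =ᶠ[𝓝 z₀] G s₀ hs₀pos := by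
      filter_upwards [hopen.mem_nhds hmem] with z hz
      have hzre : z₀.re / 2 < z.re := hz
      have hzpos : 0 < z.re := by linarith
      rw [dif_pos hzpos]
      rcases le_total (z.re / 4) s₀ with h | h
      · exact hcons (z.re / 4) (by positivity) s₀ hs₀pos h (show 2 * s₀ < z.re by rw [hs₀]; linarith)
      · exact (hcons s₀ hs₀pos (z.re / 4) (by positivity) h (show 2 * (z.re / 4) < z.re by linarith)).symm
    have hdiff : DifferentiableAt ℂ (G s₀ hs₀pos) z₀ :=
      (hGdiff s₀ hs₀pos).differentiableAt
        ((isOpen_lt continuous_const Complex.continuous_re).mem_nhds (show 2 * s₀ < z₀.re by rw [hs₀]; linarith))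
    exact (hdiff.congr_of_eventuallyEq heq).differentiableWithinAt
  · intro t ht
    have : 0 < (t : ℂ).re := by simpa using ht
    show (if h : 0 < (t : ℂ).re then G ((t : ℂ).re / 4) (by positivity) t else 0) = f t
    rw [dif_pos this]
    simp only [Complex.ofReal_re]
    exact hGreal (t / 4) (by positivity) t (by linarith)
  · intro z hz
    show ‖(if h : 0 < z.re then G (z.re / 4) (by positivity) z else 0)‖ ≤ f z.re
    rw [dif_pos hz]
    exact hGnorm (z.re / 4) (by positivity) z (by linarith)

end IsBoundedHalfLinePD

end Literature.Analysis.OperatorTheory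

end
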